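import Summits.AtomisticToContinuum.Crystallization.Theorems.PricedLinkCensusLocalToGlobalFccMirrorPointField

/-!
# The smeared Newton field and potential of the unit charge on `B(0, r) ⊂ ℝ⁸`: `C¹` regularity and bounds

Route `PricedLinkCensus`, crux `LocalToGlobal` (stmt-AtomisticToContinuum-14232), line
`flux-cell-joint-census`, support for the registered stub `stub_fccMirrorExact : NewtonShell8 → FccMirrorExact`
(`Theorems/PricedLinkCensusLocalToGlobalDefs`), second half (`fluxCell ≤ S₆`, the method of images).  For the
uniform probability `ρ = (vol B_r)⁻¹ 𝟙_{B(0,r)}` on the 8-ball (`ballDensity r`):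

* `smearedPotential r z = ⨍_{B(0,r)} ‖z - w‖⁻⁶ dw` (`2π⁴` times its Newton potential) and
  `smearedField r z = ⨍_{B(0,r)} E(z - w) dw`, `E(y) = (3/π⁴)‖y‖⁻⁸ y` (`PricedLinkCensusLocalToGlobalFccMirrorPointField`);
* the regularised potentials `v_t = farPotential t ρ` of `PricedLinkCensusLocalToGlobalThomsonPotential` have
  `∇v_t(z) = ∫ ρ(w) ∇f_t(z - w) dw` and **`‖∇v_t(z) + 2π⁴ · smearedField r z‖ ≤ C t` uniformly in `z`**
  (`∇f_t + 2π⁴E` lives in `B̄(0,t)` and is `O(‖·‖⁻⁷)` there, and `∫_{B(z,2t)} ‖z - w‖⁻⁷ dw ≤ 2π⁴ t`), while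
  `v_t → smearedPotential r` pointwise; hence (uniform limits of derivatives,
  Mathlib `hasFDerivAt_of_tendstoUniformly`) **`smearedPotential r ∈ C¹(ℝ⁸)` with
  `∇ smearedPotential r = -2π⁴ · smearedField r`**, and `smearedField r` is continuous
  (registered sub-goal `fccMirror_smearedPotential_hasGradient`);
* bounds: `‖smearedField r z‖ ≤ C (1 + ‖z‖)⁻⁷`, `|smearedPotential r z| ≤ C (1 + ‖z‖)⁻⁶`.

References: D. Gilbarg, N. S. Trudinger, *Elliptic PDE of second order* (2001), Lemma 4.1; E. H. Lieb,
M. Loss, *Analysis* (2001), Thm 6.21, §9.7, Thm 10.2.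
-/

noncomputable section

open MeasureTheory Set Filter Metric Topology InnerProductSpace Function
open scoped RealInnerProductSpace Laplacian

namespace Summit.AtomisticToContinuum.Crystallization.Theorems.PricedLinkCensusLocalToGlobal

/-! ### The uniform density on `B(0, r)` -/

/-- THE UNIFORM PROBABILITY DENSITY on the 8-ball `B(0, r)`: `ρ = (vol B(0,r))⁻¹ 𝟙_{B(0,r)}`. [folklore] -/
def ballDensity (r : ℝ) (z : E8) : ℝ := ((volume : Measure E8).real (ball 0 r))⁻¹ * (ball (0 : E8) r).indicator (fun _ => (1 : ℝ)) z

/-- THE SMEARED POTENTIAL `⨍_{B(0,r)} ‖z - w‖⁻⁶ dw` (`2π⁴` times the Newton potential of `ρ`). [folklore] -/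
def smearedPotential (r : ℝ) (z : E8) : ℝ := ⨍ w in ball (0 : E8) r, ‖z - w‖⁻¹ ^ 6

/-- THE SMEARED NEWTON FIELD `⨍_{B(0,r)} E(z - w) dw` of the unit charge on `B(0, r)`. [folklore] -/
def smearedField (r : ℝ) (z : E8) : E8 := ⨍ w in ball (0 : E8) r, pointField (z - w)

section Basic

variable {r : ℝ}

/-- `ρ ≥ 0`. [folklore] -/
theorem ballDensity_nonneg (r : ℝ) (z : E8) : 0 ≤ ballDensity r z := by
  unfold ballDensity
  exact mul_nonneg (by positivity) (indicator_nonneg (fun _ _ => zero_le_one) _)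

/-- `|ρ| ≤ (vol B(0,r))⁻¹`. [folklore] -/
theorem abs_ballDensity_le (r : ℝ) (z : E8) : |ballDensity r z| ≤ ((volume : Measure E8).real (ball 0 r))⁻¹ := by
  rw [abs_of_nonneg (ballDensity_nonneg r z), ballDensity]
  refine mul_le_of_le_one_right (by positivity) ?_
  by_cases hz : z ∈ ball (0 : E8) r
  · rw [indicator_of_mem hz]
  · rw [indicator_of_notMem hz]; exact zero_le_one

/-- `ρ = 0` off `B̄(0, r)`. [folklore] -/
theorem ballDensity_eq_zero {z : E8} (hz : r < ‖z‖) : ballDensity r z = 0 := by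
  rw [ballDensity, indicator_of_notMem (fun h => ?_), mul_zero]
  rw [mem_ball_zero_iff] at h
  linarith

/-- `ρ` is integrable. [folklore] -/
theorem integrable_ballDensity (r : ℝ) : Integrable (ballDensity r) :=
  ((integrable_indicator_iff measurableSet_ball).2 (integrableOn_const measure_ball_lt_top.ne)).const_mul _

/-- Integrals against `ρ` are ball averages: `∫ ρ(w) • g(w) dw = ⨍_{B(0,r)} g`. [folklore] -/
theorem integral_ballDensity_smul {F : Type*} [NormedAddCommGroup F] [NormedSpace ℝ F] (g : E8 → F) :
    ∫ w, ballDensity r w • g w = ⨍ w in ball (0 : E8) r, g w := by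
  rw [setAverage_eq, ← integral_indicator measurableSet_ball, ← integral_smul]
  refine integral_congr_ae (Eventually.of_forall fun w => ?_)
  by_cases hw : w ∈ ball (0 : E8) r
  · simp [ballDensity, indicator_of_mem hw]
  · simp [ballDensity, indicator_of_notMem hw]

/-- `smearedPotential r z = ∫ ρ(w) ‖z - w‖⁻⁶ dw`. [folklore] -/
theorem smearedPotential_eq_integral (r : ℝ) (z : E8) : smearedPotential r z = ∫ w, ballDensity r w * ‖z - w‖⁻¹ ^ 6 := by
  rw [smearedPotential, ← integral_ballDensity_smul]
  rfl

/-- `smearedField r z = ∫ ρ(w) • E(z - w) dw`. [folklore] -/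
theorem smearedField_eq_integral (r : ℝ) (z : E8) : smearedField r z = ∫ w, ballDensity r w • pointField (z - w) := by
  rw [smearedField, ← integral_ballDensity_smul]

end Basic

/-! ### The gradient of the regularised potentials and the uniform estimate -/

section Regularised

variable {r t : ℝ}

/-- **`∇v_t(z) = ∫ ρ(w) ∇f_t(z - w) dw`** for `v_t = farPotential t ρ`. [folklore] -/
theorem gradient_farPotential_ballDensity (ht : 0 < t) (r : ℝ) (z : E8) :
    gradient (farPotential t (ballDensity r)) z = ∫ w, ballDensity r w • gradient (newtonFar8 t) (z - w) := by
  have hint : Integrable fun w => ballDensity r w • gradient (newtonFar8 t) (z - w) :=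
    Literature.Analysis.FluidPDE.integrable_smul_comp_sub (integrable_ballDensity r) (fun w hw => ballDensity_eq_zero hw)
      (Literature.Analysis.FluidPDE.continuous_gradient_of_contDiff (contDiff_newtonFar8 ht (n := 1))) z
  refine ext_inner_right ℝ fun v => ?_
  rw [gradient, toDual_symm_apply, show farPotential t (ballDensity r) = fun x => ∫ w, ballDensity r w • newtonFar8 t (x - w)
      from rfl,
    Literature.Analysis.FluidPDE.fderiv_integral_smul_comp_sub_apply (integrable_ballDensity r)
      (fun w hw => ballDensity_eq_zero hw) (contDiff_newtonFar8 ht (n := 1)) z v,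
    real_inner_comm, ← integral_inner hint v]
  refine integral_congr_ae (Eventually.of_forall fun w => ?_)
  simp only [smul_eq_mul]
  rw [inner_smul_right, gradient, real_inner_comm, toDual_symm_apply]

/-- **The uniform estimate**: `‖∇v_t(z) + 2π⁴ smearedField r z‖ ≤ (vol B_r)⁻¹ (A + 6) 2π⁴ t` for `0 < t`, every
`z` (`A` the uniform gradient constant of `PricedLinkCensusLocalToGlobalFccMirrorPointField`). [folklore] -/
theorem norm_gradient_farPotential_add_smearedField_le {A : ℝ} (hA0 : 0 ≤ A)
    (hA : ∀ t : ℝ, 0 < t → ∀ y : E8, ‖fderiv ℝ (newtonFar8 t) y‖ ≤ A * ‖y‖⁻¹ ^ 7) (ht : 0 < t) (r : ℝ) (z : E8) :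
    ‖gradient (farPotential t (ballDensity r)) z + (2 * Real.pi ^ 4) • smearedField r z‖ ≤
      ((volume : Measure E8).real (ball 0 r))⁻¹ * (A + 6) * (2 * Real.pi ^ 4 * t) := by
  set V : ℝ := ((volume : Measure E8).real (ball 0 r))⁻¹ with hV
  have hV0 : 0 ≤ V := by positivity
  have hint1 : Integrable fun w => ballDensity r w • gradient (newtonFar8 t) (z - w) :=
    Literature.Analysis.FluidPDE.integrable_smul_comp_sub (integrable_ballDensity r) (fun w hw => ballDensity_eq_zero hw)
      (Literature.Analysis.FluidPDE.continuous_gradient_of_contDiff (contDiff_newtonFar8 ht (n := 1))) z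
  have hint2 : Integrable fun w => ballDensity r w • pointField (z - w) := by
    have h := (integrableOn_pointField_sub z 0 r).integrable_indicator measurableSet_ball
    refine (h.smul V).congr (Eventually.of_forall fun w => ?_)
    by_cases hw : w ∈ ball (0 : E8) r
    · simp [ballDensity, indicator_of_mem hw, hV]
    · simp [ballDensity, indicator_of_notMem hw]
  -- the difference as one integral
  have hdiff : gradient (farPotential t (ballDensity r)) z + (2 * Real.pi ^ 4) • smearedField r z =
      ∫ w, ballDensity r w • (gradient (newtonFar8 t) (z - w) + (2 * Real.pi ^ 4) • pointField (z - w)) := by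
    rw [gradient_farPotential_ballDensity ht, smearedField_eq_integral, ← integral_smul, ← integral_add hint1 ?_]
    · refine integral_congr_ae (Eventually.of_forall fun w => ?_)
      simp only [smul_add, smul_comm (ballDensity r w) (2 * Real.pi ^ 4)]
    · exact hint2.smul (2 * Real.pi ^ 4)
  -- the pointwise majorant
  set G : E8 → ℝ := fun w => V * ((A + 6) * (ball z (2 * t)).indicator (fun w => ‖z - w‖⁻¹ ^ 7) w) with hG
  have hGint : Integrable G :=
    (((integrableOn_inv_norm_sub_pow_seven z z (2 * t)).integrable_indicator measurableSet_ball).const_mul _).const_mul _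
  have hbd : ∀ w, ‖ballDensity r w • (gradient (newtonFar8 t) (z - w) + (2 * Real.pi ^ 4) • pointField (z - w))‖ ≤ G w :=
    fun w => by
    rw [norm_smul, Real.norm_eq_abs]
    refine mul_le_mul (abs_ballDensity_le r w) ((norm_gradient_newtonFar8_add_le hA ht (z - w)).trans ?_) (norm_nonneg _) hV0
    by_cases hw : z - w ∈ closedBall (0 : E8) t
    · have hw' : w ∈ ball z (2 * t) := by
        rw [mem_closedBall_zero_iff] at hw
        rw [mem_ball, dist_comm, dist_eq_norm]; linarith
      rw [indicator_of_mem hw, indicator_of_mem hw']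
    · rw [indicator_of_notMem hw]
      exact mul_nonneg (by linarith) (indicator_nonneg (fun _ _ => by positivity) _)
  rw [hdiff]
  refine (norm_integral_le_of_norm_le hGint (Eventually.of_forall hbd)).trans ?_
  rw [hG, integral_const_mul, integral_const_mul, integral_indicator measurableSet_ball, mul_assoc]
  refine mul_le_mul_of_nonneg_left (mul_le_mul_of_nonneg_left ?_ (by linarith)) hV0
  calc ∫ w in ball z (2 * t), ‖z - w‖⁻¹ ^ 7 ≤ Real.pi ^ 4 * (2 * t) := setIntegral_inv_norm_sub_pow_seven_le z z (by linarith)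
    _ = 2 * Real.pi ^ 4 * t := by ring

/-- **Pointwise convergence of the regularised potentials**: `v_{tₙ}(z) → smearedPotential r z` for `tₙ → 0⁺`. [folklore] -/
theorem tendsto_farPotential_ballDensity {τ : ℕ → ℝ} (hτpos : ∀ n, 0 < τ n) (hτ : Tendsto τ atTop (𝓝 0)) (r : ℝ) (z : E8) :
    Tendsto (fun n => farPotential (τ n) (ballDensity r) z) atTop (𝓝 (smearedPotential r z)) := by
  rw [smearedPotential_eq_integral]
  have hbound : Integrable fun w => ((volume : Measure E8).real (ball 0 r))⁻¹ * (ball (0 : E8) r).indicator (fun w => ‖z - w‖⁻¹ ^ 6) w :=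
    ((integrableOn_inv_norm_sub_pow_six z 0 r).integrable_indicator measurableSet_ball).const_mul _
  refine tendsto_integral_of_dominated_convergence _ (fun n => ?_) hbound (fun n => Eventually.of_forall fun w => ?_) ?_
  · exact (integrable_ballDensity r).aestronglyMeasurable.mul
      ((contDiff_newtonFar8 (hτpos n) (n := 0)).continuous.comp (continuous_const.sub continuous_id)).aestronglyMeasurable
  · rw [Real.norm_eq_abs, abs_mul, abs_of_nonneg (ballDensity_nonneg r w), ballDensity]
    by_cases hw : w ∈ ball (0 : E8) r
    · rw [indicator_of_mem hw, indicator_of_mem hw, mul_one]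
      exact mul_le_mul_of_nonneg_left (abs_newtonFar8_le _ _) (by positivity)
    · rw [indicator_of_notMem hw, indicator_of_notMem hw]; simp
  · filter_upwards [ae_ne_point z] with w hw
    refine Tendsto.const_mul _ (tendsto_const_nhds.congr' ?_)
    have hpos : 0 < ‖z - w‖ := norm_pos_iff.2 (sub_ne_zero.2 (Ne.symm hw))
    filter_upwards [(tendsto_order.1 hτ).2 _ hpos] with n hn
    exact (newtonFar8_eq_of_le (hτpos n) hn.le).symm

/-- **`smearedPotential r ∈ C¹` with `∇ smearedPotential r = -2π⁴ smearedField r`**, and `smearedField r` is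
continuous (uniform limits of the gradients of the regularised potentials). [cite: LiebLoss2001, Thm 10.2] -/
theorem hasFDerivAt_smearedPotential (r : ℝ) (z : E8) :
    HasFDerivAt (smearedPotential r) (InnerProductSpace.toDual ℝ E8 (-(2 * Real.pi ^ 4) • smearedField r z)) z ∧
      Continuous (smearedField r) := by
  obtain ⟨A, hA0, hA⟩ := exists_norm_fderiv_newtonFar8_le_uniform
  set τ : ℕ → ℝ := fun n => 1 / ((n : ℝ) + 1) with hτ
  have hτpos : ∀ n, 0 < τ n := fun n => by rw [hτ]; positivity
  have hτlim : Tendsto τ atTop (𝓝 0) := tendsto_one_div_add_atTop_nhds_zero_nat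
  set g' : E8 → E8 := fun z => -(2 * Real.pi ^ 4) • smearedField r z with hg'
  -- uniform convergence of the gradients
  have hunif : TendstoUniformly (fun n z => gradient (farPotential (τ n) (ballDensity r)) z) g' atTop := by
    set C : ℝ := ((volume : Measure E8).real (ball 0 r))⁻¹ * (A + 6) * (2 * Real.pi ^ 4) with hC
    have hC0 : 0 ≤ C := by positivity
    refine Metric.tendstoUniformly_iff.2 fun ε hε => ?_
    have hCτ : Tendsto (fun n => C * τ n) atTop (𝓝 0) := by simpa using hτlim.const_mul C
    filter_upwards [(tendsto_order.1 hCτ).2 ε hε] with n hn z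
    rw [dist_comm, dist_eq_norm]
    simp only [hg', neg_smul, sub_neg_eq_add]
    refine lt_of_le_of_lt ?_ hn
    have h := norm_gradient_farPotential_add_smearedField_le hA0 hA (hτpos n) r z
    calc _ ≤ _ := h
      _ = C * τ n := by rw [hC]; ring
  have hunif' : TendstoUniformly (fun n z => fderiv ℝ (farPotential (τ n) (ballDensity r)) z)
      (fun z => InnerProductSpace.toDual ℝ E8 (g' z)) atTop := by
    refine Metric.tendstoUniformly_iff.2 fun ε hε => ?_
    filter_upwards [Metric.tendstoUniformly_iff.1 hunif ε hε] with n hn z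
    have h := hn z
    rw [dist_eq_norm] at h ⊢
    have e : fderiv ℝ (farPotential (τ n) (ballDensity r)) z =
        InnerProductSpace.toDual ℝ E8 (gradient (farPotential (τ n) (ballDensity r)) z) := by
      rw [gradient, LinearIsometryEquiv.apply_symm_apply]
    rw [e, ← map_sub, LinearIsometryEquiv.norm_map]
    exact h
  have hdiff : ∀ n z, HasFDerivAt (farPotential (τ n) (ballDensity r)) (fderiv ℝ (farPotential (τ n) (ballDensity r)) z) z :=
    fun n z => ((contDiff_farPotential (hτpos n) (integrable_ballDensity r) (fun w hw => ballDensity_eq_zero hw) 1).differentiable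
      one_ne_zero z).hasFDerivAt
  refine ⟨hasFDerivAt_of_tendstoUniformly hunif' hdiff (tendsto_farPotential_ballDensity hτpos hτlim r) z, ?_⟩
  -- continuity of the limit field
  have hgc : Continuous g' := hunif.continuous (Eventually.of_forall fun n =>
    Literature.Analysis.FluidPDE.continuous_gradient_of_contDiff
      (contDiff_farPotential (hτpos n) (integrable_ballDensity r) (fun w hw => ballDensity_eq_zero hw) 1)).frequently
  have hne : -(2 * Real.pi ^ 4) ≠ 0 := neg_ne_zero.2 (by positivity)
  have e : smearedField r = fun z => (-(2 * Real.pi ^ 4))⁻¹ • g' z := by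
    funext z
    simp only [hg']
    rw [smul_smul, inv_mul_cancel₀ hne, one_smul]
  rw [e]
  exact (continuous_const (y := (-(2 * Real.pi ^ 4))⁻¹)).smul hgc

/-- `∇ smearedPotential r = -2π⁴ smearedField r`. [folklore] -/
theorem gradient_smearedPotential (r : ℝ) (z : E8) :
    gradient (smearedPotential r) z = -(2 * Real.pi ^ 4) • smearedField r z := by
  rw [gradient, (hasFDerivAt_smearedPotential r z).1.fderiv, LinearIsometryEquiv.symm_apply_apply]

/-- `smearedField r` is continuous. [folklore] -/
theorem continuous_smearedField (r : ℝ) : Continuous (smearedField r) := (hasFDerivAt_smearedPotential r 0).2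

/-- `smearedPotential r ∈ C¹(ℝ⁸)`. [folklore] -/
theorem contDiff_one_smearedPotential (r : ℝ) : ContDiff ℝ 1 (smearedPotential r) := by
  refine contDiff_one_iff_hasFDerivAt.2 ⟨fun z => InnerProductSpace.toDual ℝ E8 (-(2 * Real.pi ^ 4) • smearedField r z),
    ?_, fun z => (hasFDerivAt_smearedPotential r z).1⟩
  exact (InnerProductSpace.toDual ℝ E8).continuous.comp
    ((continuous_const (y := -(2 * Real.pi ^ 4))).smul (continuous_smearedField r))

/-- **Registered sub-goal `fccMirror_smearedPotential_hasGradient`** (line `flux-cell-joint-census`, support of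
`stub_fccMirrorExact`): the smeared potential of the uniform 8-ball is `C¹` with gradient `-2π⁴` times the smeared
Newton field, binder form of `hasFDerivAt_smearedPotential`. [cite: LiebLoss2001, Thm 10.2] -/
theorem fccMirror_smearedPotential_hasGradient : ∀ (r : ℝ) (z : E8),
    HasFDerivAt (smearedPotential r) (InnerProductSpace.toDual ℝ E8 (-(2 * Real.pi ^ 4) • smearedField r z)) z :=
  fun r z => (hasFDerivAt_smearedPotential r z).1

end Regularised

end Summit.AtomisticToContinuum.Crystallization.Theorems.PricedLinkCensusLocalToGlobal

end
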